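import Summits.MatrixMultiplication.MatrixMultiplication.Theorems.SoloInformedCwTwoMultDissociated

/-!
# Door D7 — multiplicative dissociativity FAILS for a weighted design of `S_3` (refutation of the MD conjecture)

Solo seat `solo-MatrixMultiplication-informed`, gen 10.  The seat conjectured (CLAIMS c124(c), c126; sharpest
statement §2h(12)–(13)) that the polynomial digits of every mixed design are multiplicatively dissociated
(`LinearIndependent ℚ (mixedProd s d t)`), which by `two_pow_le_digitSum_succ_of_multDissociated` would give
D7-closure.  This file records, in the kernel, that the product family of the digit system
`(s | d) = (1, 4, 6 | 25, 26, 12)` — an integer weighted design of `S_3` of cost `σ = 74` (design-hood is a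
finite LP fact certified by two independent engines and by the explicit Gordan vector `y = (-4,0,3,-1,1,1)`
on its eight balanced relations; it is NOT formalised here) — is linearly DEPENDENT: with `a_k = X^{s_k}`,
`B_k = X^{s_k} + X^{d_k}`,
`a₁B₁a₂a₃ − a₂a₃B₂ − B₃ + a₃ + a₁B₁B₃ − a₁B₁a₃ − B₂B₃ + a₃B₂ + a₂B₃ − a₂a₃ = 0`.
So MD (and with it the private-exponent property (★) and the Hall property) is a threshold phenomenon, not a
theorem about designs; only the counting form of the conjecture survives (CLAIMS c131).
-/

set_option linter.dupNamespace false

namespace Summit.MatrixMultiplication.MatrixMultiplication.Theorems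

open Polynomial

/-- Small digits of the `σ = 74` design of `S_3`: `s = (1, 4, 6)`. -/
def cexS : Fin 3 → ℕ := ![1, 4, 6]

/-- Large digits of the `σ = 74` design of `S_3`: `d = (25, 26, 12)`. -/
def cexD : Fin 3 → ℕ := ![25, 26, 12]

/-- The ten index sets of the dependency (generators `a_k = inl k`, `B_k = inr (inl k)`). -/
def cexSets : Fin 10 → Finset (MixedIdx 3 0) :=
  ![{Sum.inl 0, Sum.inr (Sum.inl 0), Sum.inl 1, Sum.inl 2},   -- a₁B₁a₂a₃
    {Sum.inl 1, Sum.inl 2, Sum.inr (Sum.inl 1)},              -- a₂a₃B₂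
    {Sum.inr (Sum.inl 2)},                                    -- B₃
    {Sum.inl 2},                                              -- a₃
    {Sum.inl 0, Sum.inr (Sum.inl 0), Sum.inr (Sum.inl 2)},    -- a₁B₁B₃
    {Sum.inl 0, Sum.inr (Sum.inl 0), Sum.inl 2},              -- a₁B₁a₃
    {Sum.inr (Sum.inl 1), Sum.inr (Sum.inl 2)},               -- B₂B₃
    {Sum.inl 2, Sum.inr (Sum.inl 1)},                         -- a₃B₂
    {Sum.inl 1, Sum.inr (Sum.inl 2)},                         -- a₂B₃
    {Sum.inl 1, Sum.inl 2}]                                   -- a₂a₃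

/-- The signs of the dependency. -/
def cexCoeff : Fin 10 → ℚ := ![1, -1, -1, 1, 1, -1, -1, 1, 1, -1]

/-- The ten signed products sum to zero (a polynomial identity in `ℚ[X]`). -/
theorem cex_relation :
    ∑ i, cexCoeff i • mixedProd cexS cexD ![] (cexSets i) = 0 := by
  simp [Fin.sum_univ_succ, cexCoeff, cexSets, mixedProd, mixedGen, cexS, cexD,
    Finset.prod_insert, Finset.prod_singleton]
  ring

/-- The ten index sets are pairwise distinct. -/
theorem cexSets_injective : Function.Injective cexSets := by
  decide

/-- **MD fails for a design.** The subset products of the polynomial digits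
`{X, X + X^25, X^4, X^4 + X^26, X^6, X^6 + X^12}` of the `σ = 74` weighted design of `S_3` are linearly
dependent over `ℚ`. [new; seat solo-informed, door D7, refutes the seat's MD conjecture c124(c)/c126] -/
theorem not_linearIndependent_mixedProd_cex :
    ¬ LinearIndependent ℚ (mixedProd cexS cexD ![]) := by
  intro h
  have h10 := h.comp cexSets cexSets_injective
  have := (Fintype.linearIndependent_iff.mp h10) cexCoeff (by simpa using cex_relation) 0
  simp [cexCoeff] at this

end Summit.MatrixMultiplication.MatrixMultiplication.Theorems
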